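import Literature.NumberTheory.LFunctions.Zhang2022.MainTermFormEll
import Literature.NumberTheory.LFunctions.Zhang2022.KnifeEdgeEllScales
import Literature.NumberTheory.LFunctions.Zhang2022.DetectorShiftAdmissible
import Literature.NumberTheory.LFunctions.Zhang2022.MainTermFormEllRecipe

/-!
# §D edge ell — card `ell-vernier-far-pair` (ls-knife-ell-idea-2, filed 2026-08-26T22:27Z): first lemmas, typed

Y. Zhang, *Discrete mean estimates and the Landau–Siegel zero*, arXiv:2211.02515v1 [Zhang2022LandauSiegel] — an
unrefereed manuscript under adjudication. **WHAT THIS IS NOT: not a claim about Theorems 1–2 of arXiv:2211.02515,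
about Landau–Siegel zeros, about Parity, or about a repaired `Margin232`; every bare `Prop` below is a DEFINITION
asserted by no one.** «The programme SEARCHES and TYPES; no claim about Landau–Siegel zeros, Theorems 1–2 of
arXiv:2211.02515 or a repaired Margin232 until a kernel theorem says so.» (LANDAU–SIEGEL programme F-S3, cell
`landau-siegel`, §D edge ell; typer ls-knife-typer-2 g2; card file `knife/ell/idea-2/CARD-ell-vernier-far-pair.md`
sha16 42b2249874b87f56, ideator's sketch `Sketch-ell-vernier-far-pair.lean` sha16 bf97c683a55bb89d; critic instrument
knife/ell/CRIT-2.md F-ℓ12.)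

## The card, verbatim (mechanism lines)
* Lever: «ONE new admissible shift pair ≍ θ𝓛⁸ fence gaps away inside 𝔠* (a vernier between the zero fence and the
  reflection grid), turning the sub-resolution scale mismatch ℓ−1 ≍ 𝓛⁻⁸ into an O(1) root-versus-grid offset θ of a
  one-parameter family of explicit main-term forms 𝔅^V_θ at the printed parameters.»
* First lemma: «PROVED `vernier_signAdmissible` … and `vernier_not_inShiftBox` …, `realDir_natCast`; STATED (typer-2,
  option (a) = pure analysis on F_ℓ): `RealFreqClosedForm` (F_ℓ(e^{−iπξy}) = (8π/ξ)(ξ−ℓ)(ξ−2ℓ)(ξ−3ℓ) +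
  (16ℓ/ξ²)(ξ²−3ℓξ+3ℓ²) sin πξ, ξ ≠ 0), `RootDirValue` (F_ℓ(e^{−iπℓy}) = 16ℓ sin πℓ), `RootDirNeg` (< 0 for
  1 < ℓ < 2), and option (b) pins `vernierJ`/`vernierOffset`/`VernierOffsetMacroscopic` over `EllScales.Scales`.»

## Typed here (the card's FL0–FL4, in the tree's vocabulary; nothing else)
* FL0 `vernierShifts b₀ J m = (b₀; J+m, J+1−m)` with PROVED `vernier_signAdmissible` (`Det.SignAdmissible`, witness
  `k = J`, every `J ≥ 1`, `0 < m < 1/2`) and PROVED `vernier_not_inShiftBox` (`¬ Det.InShiftBox` once `J ≥ 5`).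
  UNITS CAVEAT (critic's F-ℓ12, not resolved here): `Det.SignAdmissible` reads `b` in units of the fence of
  Prop. 2.2 (iii); the card places the far pair on the TRUE (A)-fence (`α̃ = π/L_Δ`), whose coherence `J` gaps away is
  its crux K2 — FL0 is the sign-box SHAPE, not the positivity statement K4.
* `realFreq ξ`, `realDir ξ`, `realDir' ξ` (real-frequency directions `e^{−iπξy}`; `realDir_natCast : realDir j = afeDir j`).
* FL1 `RealFreqClosedForm`, FL2 `RootDirValue`, FL3 `RootDirNeg` as the card states them (named `Prop`s) — ALL
  THREE DISCHARGED below (`mainTermFormEll_realDir`, `realFreqClosedForm_holds`, `rootDirValue_holds`,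
  `rootDirNeg_holds`; bookkeeping `rootDirValue_of_closedForm`, `rootDirNeg_of_rootDirValue`).
* FL4 `vernierJ`, `vernierOffset` over `EllScales.Scales` and `VernierOffsetMacroscopic` — PROVED
  (`vernierOffsetMacroscopic_holds`, floor arithmetic), kept also as the card's named `Prop`.
* Cruxes (section `Cruxes`, appended): K4 `VernierPositivity θ c'` (Lemma 2.3's conclusion for the vernier weight
  `cstarVernier` = `−i·M(ρ+β₁)M(ρ+β_J)M(ρ+β_J′)/M′(ρ)`, far pair `betaFar/betaFar'` on the TRUE fence
  `alphaFence D p = π/L_Δ(p)`, `J = vernierJAt`, margin `vernierMargin D = 𝓛^{−1/4}`, coherent sub-family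
  `CoherentMember`) and K2 `VernierCoherence θ Φ'` (chains of consecutive product zeros follow `Σ π/Φ′` to
  `o(𝓛^{−1/4})·α̃`; `Φ′` an explicit PARAMETER because the card leaves its «p∣D and Stirling terms» unspelled) —
  bare `Prop`s, the card's OPEN obligations. NOT typed: K1 (sign of `𝔅^V_θ`) and K3 (main term) — the card
  deliberately does not guess `𝔅^V_θ` (D1). Section `Control`: the θ-BLIND member `vernierRecipe b₀ J m :=
  Det.shiftRecipe (vernierShifts b₀ J m)` and the E*-S slot instance `VernierThetaBlindPSD` (the card's sanity clause;
  PROVED at the printed design `vernierThetaBlindPSD_printed`). Section `Booking` (critic's REQUEST 23:54:54Z):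
  `bookedRecipe b δ φ` (weights `shiftW b j·e^{iπφ_j}`, coefficients `((1+δ)b, (1+δ)s, (1+δ)²n)`; `bookedRecipe_zero`
  = `shiftRecipe`, `bookedRecipe_std_dilate` = `ellRecipe ℓ`), `vernierBooked`, `VernierBookedPSD` (the certified-scan
  target; OPEN) — a PARAMETRISATION of D1, the functions `δ(θ), φ(θ)` being the deriver's. Section `Pinned` (author's
  answer 23:59:54Z): `PhiFence D x t := L_Δ(p)`, `pi_div_phiFence`, `VernierCoherenceFence θ := VernierCoherence θ PhiFence`.
* Delta vs the knife-edge theorems of record: `mainTermFormEll_neg_of_one_lt` (p429407) is negativity at offset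
  `ℓ − 1` on the GRID direction `e^{−iπy}`; FL2/FL3 are negativity `16ℓ sin πℓ < 0` on the displaced ROOT direction
  `e^{−iπℓy}` at O(1) offset `ℓ ∈ (1,2)`; `Det.signAdmissible_ellRecipe_iff` (p465993) says the `ℓ`-SCALED triple leaves
  the sign box for `ℓ > 1`, whereas the vernier triple stays inside it for every `J` (FL0a).
-/

noncomputable section

open scoped Real ComplexConjugate

namespace Literature.NumberTheory.LFunctions.Zhang2022.KnifeEdgeEll.Vernier

open Literature.NumberTheory.LFunctions.Zhang2022

/-! ## FL0 — the vernier shift triple and Lemma 2.3's typed sign box -/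

/-- The vernier shift triple in fence units: `b₀` sub-gap, the far pair `J + m < J + 1 − m` inside the `J`-th gap with
margin `m` (card `ell-vernier-far-pair`, Mechanism/Move). [cite: Zhang2022LandauSiegel, §2 (2.13), Lemma 2.3] -/
def vernierShifts (b₀ : ℝ) (J : ℕ) (m : ℝ) : Fin 3 → ℝ := ![b₀, (J : ℝ) + m, (J : ℝ) + 1 - m]

/-- **FL0a (PROVED): the vernier triple is sign-admissible** — Lemma 2.3's hypothesis shape `Det.SignAdmissible`
with witness `k = J`, for every `J ≥ 1`, `0 < b₀ ≤ 1` and margin `0 < m < 1/2` (the sign box quantifies over ANY gap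
index `k`; the printed design uses `k = 2`). [cite: Zhang2022LandauSiegel, §2 Lemma 2.3 and its proof p.12, (2.13)] -/
theorem vernier_signAdmissible {b₀ m : ℝ} {J : ℕ} (hb₀ : 0 < b₀) (hb₀' : b₀ ≤ 1) (hJ : 1 ≤ J)
    (hm : 0 < m) (hm' : m < 1 / 2) : Det.SignAdmissible (vernierShifts b₀ J m) := by
  have hJr : (1 : ℝ) ≤ (J : ℝ) := by exact_mod_cast hJ
  refine ⟨?_, ?_, ?_, ?_, J, ?_, ?_⟩ <;> simp [vernierShifts] <;> linarith

/-- **FL0b (PROVED): the vernier triple leaves the Part-III shift box** `Det.InShiftBox` (`b < 5`, the contour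
`|s| = 5α` of (14.2)) once `J ≥ 5` — the card's crux K3 pays for re-cutting that contour.
[cite: Zhang2022LandauSiegel, §2 (2.13); §14 (14.2)] -/
theorem vernier_not_inShiftBox {b₀ m : ℝ} {J : ℕ} (hJ : 5 ≤ J) (hm : 0 ≤ m) :
    ¬ Det.InShiftBox (vernierShifts b₀ J m) := by
  have hJr : (5 : ℝ) ≤ (J : ℝ) := by exact_mod_cast hJ
  intro h
  have h1 := (h 1).2
  simp [vernierShifts] at h1
  linarith

/-! ## FL1–FL3 — the deformed main-term form `F_ℓ` on REAL-frequency directions `e^{−iπξy}` -/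

/-- The frequency constant `−iπξ` of the direction `e^{−iπξy}` for REAL `ξ` (`realFreq j = afeFreq j`).
[cite: Zhang2022LandauSiegel, §2 (2.10), (2.13)] -/
def realFreq (ξ : ℝ) : ℂ := -((ξ : ℂ) * π * Complex.I)

/-- The pure-frequency profile `e^{−iπξy}`, real `ξ` (the AFE directions `afeDir j` are `ξ = j`).
[cite: Zhang2022LandauSiegel, §2 (2.10), (2.13)] -/
def realDir (ξ : ℝ) (y : ℝ) : ℂ := Complex.exp (realFreq ξ * y)

/-- Its derivative `−iπξ·e^{−iπξy}`. [cite: Zhang2022LandauSiegel, §2 (2.10), (2.13)] -/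
def realDir' (ξ : ℝ) (y : ℝ) : ℂ := realFreq ξ * realDir ξ y

/-- `realFreq j = afeFreq j` at integer frequencies. [cite: Zhang2022LandauSiegel, §2 (2.13)] -/
theorem realFreq_natCast (j : ℕ) : realFreq (j : ℝ) = afeFreq j := by
  simp [realFreq, afeFreq]

/-- Consistency with the tree's integer directions: `realDir j = afeDir j`. [cite: Zhang2022LandauSiegel, §2 (2.13)] -/
theorem realDir_natCast (j : ℕ) : realDir (j : ℝ) = afeDir j := by
  funext y
  simp [realDir, afeDir, realFreq, afeFreq]

/-- … and `realDir' j = afeDir' j`. [cite: Zhang2022LandauSiegel, §2 (2.13)] -/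
theorem realDir'_natCast (j : ℕ) : realDir' (j : ℝ) = afeDir' j := by
  funext y
  rw [realDir', afeDir', realFreq_natCast, realDir_natCast]

/-- **FL1 (the card's support item P3, stated as the card states it; an elementary interval-integral identity over
`mainTermFormEll`, NOT yet proved here):** for real `ξ ≠ 0`,
`F_ℓ(e^{−iπξy}) = (8π/ξ)(ξ−ℓ)(ξ−2ℓ)(ξ−3ℓ) + (16ℓ/ξ²)(ξ² − 3ℓξ + 3ℓ²)·sin πξ` — bulk with roots displaced to
`ℓ, 2ℓ, 3ℓ` plus a boundary term vanishing on the integer grid (at `ξ = j` this is `mainTermFormEll_afeDir`).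
A DEFINITION of the statement; its proof is owed (pieces: `∫‖g′‖² = π²ξ²`, `Im∫g′ḡ = −πξ`, `Im g(0)ḡ(1) = sin πξ`,
`∫‖g‖² = 1`, `Re(conj(∫g)(g0 + g1)) = 2 sin(πξ)/(πξ)`, `Im∫g·conj(∫₀ˣg) = sin(πξ)/(π²ξ²) − 1/(πξ)`).
[cite: Zhang2022LandauSiegel, §2 (2.10), (2.13)] -/
def RealFreqClosedForm : Prop :=
  ∀ ℓ ξ : ℝ, ξ ≠ 0 →
    mainTermFormEll ℓ (realDir ξ) (realDir' ξ)
      = 8 * π * ((ξ - ℓ) * (ξ - 2 * ℓ) * (ξ - 3 * ℓ)) / ξ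
        + 16 * ℓ * ((ξ ^ 2 - 3 * ℓ * ξ + 3 * ℓ ^ 2) / ξ ^ 2) * Real.sin (π * ξ)

/-- **FL2 (card P3, stated): at the displaced root `ξ = ℓ` only the boundary term survives:**
`F_ℓ(e^{−iπℓy}) = 16ℓ·sin πℓ` (`ℓ ≠ 0`). [cite: Zhang2022LandauSiegel, §2 (2.10), (2.13)] -/
def RootDirValue : Prop :=
  ∀ ℓ : ℝ, ℓ ≠ 0 → mainTermFormEll ℓ (realDir ℓ) (realDir' ℓ) = 16 * ℓ * Real.sin (π * ℓ)

/-- **FL3 (card P3, stated): `F_ℓ(e^{−iπℓy}) < 0` for `1 < ℓ < 2`** — O(1) negativity at O(1) root-versus-grid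
offset (compare `mainTermFormEll_neg_of_one_lt`: negativity of the GRID direction `e^{−iπy}` at offset `ℓ − 1`).
[cite: Zhang2022LandauSiegel, §2 (2.10), (2.13)] -/
def RootDirNeg : Prop :=
  ∀ ℓ : ℝ, 1 < ℓ → ℓ < 2 → mainTermFormEll ℓ (realDir ℓ) (realDir' ℓ) < 0

/-- FL1 ⇒ FL2 (PROVED bookkeeping: at `ξ = ℓ` the bulk `(ξ−ℓ)(ξ−2ℓ)(ξ−3ℓ)` vanishes and
`(16ℓ/ℓ²)(ℓ² − 3ℓ² + 3ℓ²) = 16ℓ`). [cite: Zhang2022LandauSiegel, §2 (2.10), (2.13)] -/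
theorem rootDirValue_of_closedForm (h : RealFreqClosedForm) : RootDirValue := by
  intro ℓ hℓ
  rw [h ℓ ℓ hℓ]
  field_simp
  ring

/-- FL2 ⇒ FL3 (PROVED bookkeeping: `sin πℓ < 0` for `1 < ℓ < 2`). [cite: Zhang2022LandauSiegel, §2 (2.10), (2.13)] -/
theorem rootDirNeg_of_rootDirValue (h : RootDirValue) : RootDirNeg := by
  intro ℓ h1 h2
  rw [h ℓ (by linarith)]
  have hs : Real.sin (π * ℓ) < 0 := by
    have e : Real.sin (π * ℓ) = -Real.sin (π * (ℓ - 1)) := by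
      rw [show π * ℓ = π * (ℓ - 1) + π by ring, Real.sin_add_pi]
    rw [e, neg_lt_zero]
    apply Real.sin_pos_of_pos_of_lt_pi
    · nlinarith [Real.pi_pos]
    · nlinarith [Real.pi_pos]
  have hℓ : 0 < 16 * ℓ := by linarith
  exact mul_neg_of_pos_of_neg hℓ hs

/-! ## FL4 — the vernier pins over the exact scales (`EllScales.Scales`, p456970) -/

/-- **Number of fence gaps to the far pair realising the offset `θ`:** `J(θ) = ⌊θ/(ℓ(p) − 1)⌋₊`
(`ℓ(p) = EllScales.Scales.ell`, `ℓ(p) − 1 ≍ 𝓛/(2𝓛⁹)` at the pinned scales, so `J ≍ 2θ𝓛⁸`).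
[cite: Zhang2022LandauSiegel, §2 (2.6), (2.10)] -/
def vernierJ (S : EllScales.Scales) (p θ : ℝ) : ℕ := ⌊θ / (S.ell p - 1)⌋₊

/-- **Accumulated root-versus-grid offset of a pair `J` gaps away:** `J·(ℓ(p) − 1)`.
[cite: Zhang2022LandauSiegel, §2 (2.6), (2.10)] -/
def vernierOffset (S : EllScales.Scales) (p : ℝ) (J : ℕ) : ℝ := (J : ℝ) * (S.ell p - 1)

/-- **FL4 (card P3, as stated): the vernier realises every offset `θ > 0` to within one per-gap step `ℓ − 1`**
(with `EllScales.Scales.one_lt_ell` the step is positive). Kept as the card's named `Prop`; PROVED below.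
[cite: Zhang2022LandauSiegel, §2 (2.6), (2.10)] -/
def VernierOffsetMacroscopic : Prop :=
  ∀ (S : EllScales.Scales) (p θ : ℝ), 1 < S.ell p → 0 < θ →
    |vernierOffset S p (vernierJ S p θ) - θ| ≤ S.ell p - 1

/-- **FL4 is a theorem** (floor arithmetic: `J ≤ θ/s < J + 1` with `s = ℓ − 1 > 0` gives `0 ≤ θ − Js < s`).
[cite: Zhang2022LandauSiegel, §2 (2.6), (2.10)] -/
theorem vernierOffsetMacroscopic_holds : VernierOffsetMacroscopic := by
  intro S p θ hℓ hθ
  have hs : 0 < S.ell p - 1 := by linarith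
  set s := S.ell p - 1 with hs_def
  have hq : 0 ≤ θ / s := div_nonneg hθ.le hs.le
  have h1 : (⌊θ / s⌋₊ : ℝ) ≤ θ / s := Nat.floor_le hq
  have h2 : θ / s < (⌊θ / s⌋₊ : ℝ) + 1 := Nat.lt_floor_add_one _
  unfold vernierOffset vernierJ
  rw [← hs_def]
  have h1' : (⌊θ / s⌋₊ : ℝ) * s ≤ θ := by
    have := mul_le_mul_of_nonneg_right h1 hs.le
    rwa [div_mul_cancel₀ θ hs.ne'] at this
  have h2' : θ < (⌊θ / s⌋₊ : ℝ) * s + s := by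
    have := mul_lt_mul_of_pos_right h2 hs
    rw [div_mul_cancel₀ θ hs.ne', add_mul, one_mul] at this
    exact this
  rw [abs_le]
  constructor <;> linarith

/-! ## FL1–FL3 DISCHARGED — the real-frequency closed form is a theorem (typer's proof; elementary calculus,
the same four integrals as `mainTermFormEll_afeDir` with the boundary value `e^{−iπξ}` in place of `(−1)^j`) -/

/-- `Re(−iπξ) = 0`. [cite: Zhang2022LandauSiegel, §2 (2.10), (2.13)] -/
theorem realFreq_re (ξ : ℝ) : (realFreq ξ).re = 0 := by simp [realFreq]

/-- `Im(−iπξ) = −ξπ`. [cite: Zhang2022LandauSiegel, §2 (2.10), (2.13)] -/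
theorem realFreq_im (ξ : ℝ) : (realFreq ξ).im = -(ξ * π) := by simp [realFreq]

/-- `−iπξ ≠ 0` for `ξ ≠ 0`. [cite: Zhang2022LandauSiegel, §2 (2.10), (2.13)] -/
theorem realFreq_ne_zero {ξ : ℝ} (hξ : ξ ≠ 0) : realFreq ξ ≠ 0 := by
  intro h
  have him := congrArg Complex.im h
  rw [realFreq_im, Complex.zero_im, neg_eq_zero] at him
  rcases mul_eq_zero.mp him with h1 | h2
  · exact hξ h1
  · exact Real.pi_ne_zero h2

/-- `conj(−iπξ) = iπξ`. [cite: Zhang2022LandauSiegel, §2 (2.10), (2.13)] -/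
theorem conj_realFreq (ξ : ℝ) : conj (realFreq ξ) = -realFreq ξ := by
  apply Complex.ext <;> simp [realFreq]

/-- `1/(−iπξ) = i/(ξπ)`. [cite: Zhang2022LandauSiegel, §2 (2.10), (2.13)] -/
theorem inv_realFreq {ξ : ℝ} (hξ : ξ ≠ 0) :
    (realFreq ξ)⁻¹ = ((1 / (ξ * π) : ℝ) : ℂ) * Complex.I := by
  have hπ : π ≠ 0 := Real.pi_ne_zero
  apply inv_eq_of_mul_eq_one_right
  apply Complex.ext <;> (simp [realFreq, Complex.mul_re, Complex.mul_im]; try field_simp)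

/-- `‖−iπξ‖ = |ξ|π`. [cite: Zhang2022LandauSiegel, §2 (2.10), (2.13)] -/
theorem norm_realFreq (ξ : ℝ) : ‖realFreq ξ‖ = |ξ| * π := by
  rw [realFreq, norm_neg, norm_mul, norm_mul, Complex.norm_real, Complex.norm_real, Complex.norm_I,
    Real.norm_eq_abs, Real.norm_eq_abs, abs_of_pos Real.pi_pos, mul_one]

/-- `|e^{−iπξy}| = 1`. [cite: Zhang2022LandauSiegel, §2 (2.10), (2.13)] -/
theorem norm_realDir (ξ y : ℝ) : ‖realDir ξ y‖ = 1 := by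
  rw [realDir, Complex.norm_exp, Complex.mul_re, realFreq_re, realFreq_im, Complex.ofReal_re,
    Complex.ofReal_im]
  simp

/-- `e^{−iπξy}·conj = 1`. [cite: Zhang2022LandauSiegel, §2 (2.10), (2.13)] -/
theorem realDir_mul_conj (ξ y : ℝ) : realDir ξ y * conj (realDir ξ y) = 1 := by
  rw [Complex.mul_conj', norm_realDir]; simp

/-- `e^{−iπξ·0} = 1`. [cite: Zhang2022LandauSiegel, §2 (2.10), (2.13)] -/
theorem realDir_zero (ξ : ℝ) : realDir ξ 0 = 1 := by simp [realDir]

/-- `Re e^{−iπξ} = cos πξ`. [cite: Zhang2022LandauSiegel, §2 (2.10), (2.13)] -/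
theorem realDir_one_re (ξ : ℝ) : (realDir ξ 1).re = Real.cos (π * ξ) := by
  rw [realDir, Complex.ofReal_one, mul_one, Complex.exp_re, realFreq_re, realFreq_im, Real.exp_zero, one_mul,
    Real.cos_neg, mul_comm]

/-- `Im e^{−iπξ} = −sin πξ`. [cite: Zhang2022LandauSiegel, §2 (2.10), (2.13)] -/
theorem realDir_one_im (ξ : ℝ) : (realDir ξ 1).im = -Real.sin (π * ξ) := by
  rw [realDir, Complex.ofReal_one, mul_one, Complex.exp_im, realFreq_re, realFreq_im, Real.exp_zero, one_mul,
    Real.sin_neg, mul_comm]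

/-- `e^{−iπξy}` is continuous in `y`. [cite: Zhang2022LandauSiegel, §2 (2.10), (2.13)] -/
theorem continuous_realDir (ξ : ℝ) : Continuous (realDir ξ) := by unfold realDir; fun_prop

/-- `∫₀ˣ e^{−iπξt}dt = (e^{−iπξx} − 1)/(−iπξ)` (`ξ ≠ 0`). [cite: Zhang2022LandauSiegel, §2 (2.10), (2.13)] -/
theorem primitive_realDir {ξ : ℝ} (hξ : ξ ≠ 0) (x : ℝ) :
    ∫ t in (0:ℝ)..x, realDir ξ t = (realDir ξ x - 1) / realFreq ξ := by
  simp only [realDir]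
  rw [integral_exp_mul_complex (realFreq_ne_zero hξ)]
  simp

/-- **FL1 PROVED: the real-frequency closed form of `F_ℓ`** (`realFreqClosedForm_holds : RealFreqClosedForm`).
For real `ξ ≠ 0`: `F_ℓ(e^{−iπξy}) = (8π/ξ)(ξ−ℓ)(ξ−2ℓ)(ξ−3ℓ) + (16ℓ/ξ²)(ξ²−3ℓξ+3ℓ²) sin πξ`.
[cite: Zhang2022LandauSiegel, §2 (2.10), (2.13)] -/
theorem mainTermFormEll_realDir (ℓ : ℝ) {ξ : ℝ} (hξ : ξ ≠ 0) :
    mainTermFormEll ℓ (realDir ξ) (realDir' ξ)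
      = 8 * π * ((ξ - ℓ) * (ξ - 2 * ℓ) * (ξ - 3 * ℓ)) / ξ
        + 16 * ℓ * ((ξ ^ 2 - 3 * ℓ * ξ + 3 * ℓ ^ 2) / ξ ^ 2) * Real.sin (π * ξ) := by
  have hc := realFreq_ne_zero hξ
  have hπ : π ≠ 0 := Real.pi_ne_zero
  have p1 : ∀ x, ‖realDir' ξ x‖ ^ 2 = (|ξ| * π) ^ 2 := by
    intro x; rw [realDir', norm_mul, norm_realDir, mul_one, norm_realFreq]
  have p2 : ∀ x, realDir' ξ x * conj (realDir ξ x) = realFreq ξ := by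
    intro x; rw [realDir', mul_assoc, realDir_mul_conj, mul_one]
  have p3 : ∀ x, ‖realDir ξ x‖ ^ 2 = 1 := by intro x; rw [norm_realDir, one_pow]
  have p4 : ∀ x, realDir ξ x * conj (∫ t in (0:ℝ)..x, realDir ξ t) =
      (realDir ξ x - 1) / realFreq ξ := by
    intro x
    rw [primitive_realDir hξ, map_div₀, map_sub, map_one, conj_realFreq]
    have h1 := realDir_mul_conj ξ x
    field_simp
    linear_combination (-1 : ℂ) * h1
  have T1 : ∫ x in (0:ℝ)..1, ‖realDir' ξ x‖ ^ 2 = (|ξ| * π) ^ 2 := by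
    simp only [p1, intervalIntegral.integral_const, sub_zero, smul_eq_mul, one_mul]
  have T2 : ∫ x in (0:ℝ)..1, realDir' ξ x * conj (realDir ξ x) = realFreq ξ := by
    simp only [p2, intervalIntegral.integral_const, sub_zero, one_smul]
  have T3 : ∫ x in (0:ℝ)..1, ‖realDir ξ x‖ ^ 2 = 1 := by
    simp only [p3, intervalIntegral.integral_const, sub_zero, smul_eq_mul, mul_one]
  have T4 : ∫ x in (0:ℝ)..1, realDir ξ x * conj (∫ t in (0:ℝ)..x, realDir ξ t) =
      ((realDir ξ 1 - 1) / realFreq ξ - 1) / realFreq ξ := by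
    simp only [p4]
    rw [intervalIntegral.integral_div,
      intervalIntegral.integral_sub ((continuous_realDir ξ).intervalIntegrable 0 1)
        intervalIntegrable_const,
      primitive_realDir hξ 1, intervalIntegral.integral_const]
    simp
  have hsq : (|ξ| * π) ^ 2 = ξ ^ 2 * π ^ 2 := by rw [mul_pow, sq_abs]
  rw [mainTermFormEll, T1, T2, T3, T4, primitive_realDir hξ 1, realDir_zero, hsq]
  have hEre := realDir_one_re ξ
  have hEim := realDir_one_im ξ
  set E := realDir ξ 1 with hE
  simp only [div_eq_mul_inv, inv_realFreq hξ, map_mul, map_sub, map_one, Complex.conj_ofReal,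
    Complex.conj_I, Complex.add_re, Complex.sub_re, Complex.mul_re, Complex.neg_re, Complex.add_im,
    Complex.sub_im, Complex.mul_im, Complex.neg_im, Complex.ofReal_re, Complex.ofReal_im, Complex.I_re,
    Complex.I_im, Complex.one_re, Complex.one_im, realFreq_im, Complex.conj_re, Complex.conj_im,
    hEre, hEim]
  field_simp
  ring

/-- **FL1 discharged.** [cite: Zhang2022LandauSiegel, §2 (2.10), (2.13)] -/
theorem realFreqClosedForm_holds : RealFreqClosedForm := fun ℓ _ hξ => mainTermFormEll_realDir ℓ hξ

/-- **FL2 discharged:** `F_ℓ(e^{−iπℓy}) = 16ℓ sin πℓ` (`ℓ ≠ 0`). [cite: Zhang2022LandauSiegel, §2 (2.10), (2.13)] -/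
theorem rootDirValue_holds : RootDirValue := rootDirValue_of_closedForm realFreqClosedForm_holds

/-- **FL3 discharged:** `F_ℓ(e^{−iπℓy}) < 0` for `1 < ℓ < 2` — the displaced ROOT direction is a negative direction
of `F_ℓ` at every O(1) offset `ℓ ∈ (1,2)` (at `ℓ = 3/2`: `F = 24·sin(3π/2) = −24`).
[cite: Zhang2022LandauSiegel, §2 (2.10), (2.13)] -/
theorem rootDirNeg_holds : RootDirNeg := rootDirNeg_of_rootDirValue rootDirValue_holds

/-- The root direction at `ℓ ∈ (1,2)` as an `EllClosesPos`-type witness in the `C¹` class: `realDir ℓ` is `C¹`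
(indeed smooth) and `F_ℓ(realDir ℓ) < 0`. [cite: Zhang2022LandauSiegel, §2 (2.10), (2.13)] -/
theorem exists_neg_realDir {ℓ : ℝ} (h1 : 1 < ℓ) (h2 : ℓ < 2) :
    ∃ ξ : ℝ, mainTermFormEll ℓ (realDir ξ) (realDir' ξ) < 0 :=
  ⟨ℓ, rootDirNeg_holds ℓ h1 h2⟩

/-! ## The card's cruxes K4 (POSITIVITY) and K2 (COHERENCE), typed AS THE CARD STATES THEM at the printed scales
(`Skeleton.*`, `P = exp 𝓛⁹`), the far pair measured on the TRUE fence `α̃(p) = π/L_Δ(p)`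
(`EllScales.Scales.pinned D`, `.LDelta`); bare `Prop`s asserted by no one — these are the card's OPEN obligations,
not facts in print. K1 (sign of `𝔅^V_θ`) and K3 (main term) are NOT typed: the card deliberately does not guess
the vernier form `𝔅^V_θ` (its D1). -/

section Cruxes

open Skeleton

/-- The TRUE-fence unit at member modulus `p`: `α̃(p) = π/L_Δ(p)`, `L_Δ(p) = log(p√D·t₀)` ((2.10): gap
`≃ 2π/log(Dp²t₀²)`), read at the printed scales. [cite: Zhang2022LandauSiegel, §2 (2.10)] -/
def alphaFence (D : ℕ) (p : ℝ) : ℝ := π / (EllScales.Scales.pinned D).LDelta p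

/-- The vernier gap count at member modulus `p` and offset `θ`: `J = ⌊θ/(ℓ(p) − 1)⌋₊` at the printed scales
(`vernierJ` over `EllScales.Scales.pinned D`; `≍ 2θ𝓛⁸`). [cite: Zhang2022LandauSiegel, §2 (2.6), (2.10)] -/
def vernierJAt (θ : ℝ) (D : ℕ) (p : ℝ) : ℕ := vernierJ (EllScales.Scales.pinned D) p θ

/-- The card's margin `m = 𝓛^{−1/4}` (`𝓛 = log D = Skeleton.ell D`). [cite: Zhang2022LandauSiegel, §2 (2.13)] -/
def vernierMargin (D : ℕ) : ℝ := (ell D) ^ (-(1 / 4 : ℝ))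

/-- The lower far shift `β_J = iα̃(p)·(J + m)`. [cite: Zhang2022LandauSiegel, §2 (2.13)] -/
def betaFar (θ : ℝ) (D : ℕ) (p : ℝ) : ℂ :=
  Complex.I * ((alphaFence D p * ((vernierJAt θ D p : ℝ) + vernierMargin D) : ℝ) : ℂ)

/-- The upper far shift `β_J′ = iα̃(p)·(J + 1 − m)`. [cite: Zhang2022LandauSiegel, §2 (2.13)] -/
def betaFar' (θ : ℝ) (D : ℕ) (p : ℝ) : ℂ :=
  Complex.I * ((alphaFence D p * ((vernierJAt θ D p : ℝ) + 1 - vernierMargin D) : ℝ) : ℂ)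

variable {D : ℕ} [NeZero D] (χ : DirichletCharacter ℂ D)

/-- **The vernier zero weight `𝔠*_J(ρ,ψ) := −i·M(ρ+β₁,ψ)M(ρ+β_J,ψ)M(ρ+β_J′,ψ)/M′(ρ,ψ)`** — Zhang's `𝔠*`
(`Skeleton.cstar`) with the sub-gap shift `β₁` of (2.13) KEPT and the pair `{β₂, β₃}` replaced by the far pair in
the `J`-th gap of the true fence (card: Mechanism/Move). [cite: Zhang2022LandauSiegel, §2 p. 5, (2.13)–(2.17)] -/
def cstarVernier (θ c' : ℝ) (D : ℕ) (x : Chr D) (ρ : ℂ) : ℂ :=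
  -Complex.I * Mfun x.ψ (ρ + beta1 c' D) * Mfun x.ψ (ρ + betaFar θ D x.p) * Mfun x.ψ (ρ + betaFar' θ D x.p)
    / deriv (Mfun x.ψ) ρ

/-- **The coherent sub-family of the card's K2/K4/P1:** `ψ ∈ Ψ₁` with
`sup_{|t − 2πt₀| ≤ 𝓛₁ + 1} |(L′/L)(1 + 2it, ψ²)| ≤ 𝓛^{1/2}` (`ψ²` = the character `ψ²` mod `p`; the card's P1
prices the complement at `≪ p𝓛^{−C}`). [cite: Zhang2022LandauSiegel, §3 p. 7 (Ψ₁); §4 (4.11)] -/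
def CoherentMember (x : Chr D) : Prop :=
  x ∈ PsiOne χ ∧
    ∀ t : ℝ, |t - 2 * π * t0 D| ≤ ell1 D + 1 →
      ‖deriv (x.ψ ^ 2).LFunction (1 + 2 * t * Complex.I) / (x.ψ ^ 2).LFunction (1 + 2 * t * Complex.I)‖
        ≤ (ell D) ^ (1 / 2 : ℝ)

/-- **Crux K4 — POSITIVITY (card rank 5; OPEN, asserted by no one):** under (A), eventually in `D`, for every
coherent member `ψ` and every sampled zero `ρ ∈ 𝔷(ψ)`, the vernier weight is real and non-negative:
`Im 𝔠*_J(ρ,ψ) = 0 ∧ 0 ≤ Re 𝔠*_J(ρ,ψ)` — Lemma 2.3's conclusion (`Skeleton.Lemma23`, whose shape this copies with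
`cstar ↦ cstarVernier` and `Ψ₁ ↦` the coherent sub-family) transported `J` gaps along the fence; with Prop. 2.2 (i)
(`ω(ρ) > 0` on the line) this is the card's «`𝔠*_J(ρ,ψ)·ω(ρ) ≥ 0`». Typed in the card's units (far pair on the true
fence `α̃(p)`, `β₁` as printed); the card's margin `m₁` on `β₁` is the printed `−5c′α𝓛` correction.
[cite: Zhang2022LandauSiegel, §2 Lemma 2.3 (tex L660–690), Prop. 2.2, (2.13)] -/
def VernierPositivity (θ c' : ℝ) : Prop :=
  ForAllLarge fun D _ χ => AssumptionA D χ →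
    ∀ x : Chr D, CoherentMember χ x → ∀ ρ ∈ zeroSet D x,
      (cstarVernier θ c' D x ρ).im = 0 ∧ 0 ≤ (cstarVernier θ c' D x ρ).re

/-- **Crux K2 — COHERENCE (card rank 3; OPEN, asserted by no one), typed with the phase derivative `Φ′_ψ` as an
EXPLICIT PARAMETER** (the card writes `Φ′_ψ(t) = L_Δ(t) − 2Re(L′/L)(1+2it,ψ²) + (explicit p∣D and Stirling
terms)` without spelling the last terms out — TYPER'S NOTE: that clause does not type as written; the ideator supplies
`Φ'`): under (A), eventually in `D`, for every coherent member and every chain `ρ₀, ρ₁, …, ρ_i` (`i ≤ J(θ,p) + 1`) of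
CONSECUTIVE product zeros (`L(s,ψ)L(s,ψχ)`, `Skeleton.prodZeroSetOmega`) in the window, the ordinates satisfy
`|(t_i − t₀) − Σ_{r<i} π/Φ′(t_r)| ≤ ε·𝓛^{−1/4}·α̃(p)` for every `ε > 0` (the card's `o(𝓛^{−1/4})·α̃`).
[cite: Zhang2022LandauSiegel, §4 (4.11), Lemmas 4.5–4.6, Prop. 2.2] -/
def VernierCoherence (θ : ℝ) (Φ' : (D : ℕ) → Chr D → ℝ → ℝ) : Prop :=
  ∀ ε : ℝ, 0 < ε → ForAllLarge fun D _ χ => AssumptionA D χ →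
    ∀ x : Chr D, CoherentMember χ x →
      ∀ (i : ℕ) (c : Fin (i + 1) → ℂ), i ≤ vernierJAt θ D x.p + 1 →
        (∀ r, c r ∈ prodZeroSetOmega χ x) →
        (∀ r : Fin i, (c r.castSucc).im < (c r.succ).im ∧
            ∀ ρ'' ∈ prodZeroSetOmega χ x, ¬ ((c r.castSucc).im < ρ''.im ∧ ρ''.im < (c r.succ).im)) →
          |((c (Fin.last i)).im - (c 0).im) - ∑ r : Fin i, π / Φ' D x (c r.castSucc).im|
            ≤ ε * vernierMargin D * alphaFence D x.p

/-- Shape check: at `J`-independent data the positivity crux has exactly the form of `Skeleton.Lemma23` restricted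
to the coherent sub-family — if `cstarVernier` is replaced by `Skeleton.cstar`, `Lemma23 c'` implies it (the
sub-family is inside `Ψ₁`; (A) unused). [cite: Zhang2022LandauSiegel, §2 Lemma 2.3] -/
theorem lemma23_restricts_to_coherent {c' : ℝ} (h : Lemma23 c') :
    ForAllLarge fun D _ χ => AssumptionA D χ →
      ∀ x : Chr D, CoherentMember χ x → ∀ ρ ∈ zeroSet D x,
        (cstar c' D x ρ).im = 0 ∧ 0 ≤ (cstar c' D x ρ).re := by
  obtain ⟨D₀, hD₀⟩ := h
  exact ⟨D₀, fun D _ χ hD hq hp _ x hx ρ hρ => hD₀ D χ hD hq hp x hx.1 ρ hρ⟩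

end Cruxes

/-! ## The θ-BLIND control form of the card's sanity clause: formula I with the tree's shift-triple recipe
(`Det.shiftRecipe`, weights `W_j(b) = b_j e^{iπ(s_j−b_j)/2}/v_j(b)` = the card's rule
`W_j = (pt₀)^{Σβ/2−β_j}·b_j/Π(b_i−b_j)` read on ONE lattice, i.e. grid = fence, `θ = 0`) on the vernier triple.
The card: «a θ-free result would prove ¬(A) for free and is excluded — a built-in sanity check»; so this member must
come out PSD if the derivation is consistent (B-AH), and it is the object the Cheapest falsifier evaluates FIRST.
The θ-dependent form `𝔅^V_θ` itself is NOT typed (card D1: not guessed). -/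

section Control

/-- **The vernier recipe at `θ = 0`** (grid = fence): `Det.shiftRecipe (vernierShifts b₀ J m)` — formula I's
three-channel recipe for the far-pair triple with the tree's residue-weight rule `Det.shiftW` (in-house, UNREVIEWED
for `b ≠ (1,2,3)`: `Det.shiftRecipe`'s docstring). [cite: Zhang2022LandauSiegel, Prop 7.1, (7.19)–(7.21); §2 (2.13)] -/
def vernierRecipe (b₀ : ℝ) (J : ℕ) (m : ℝ) : Det.DetRecipe := Det.shiftRecipe (vernierShifts b₀ J m)

/-- Its shifts are the vernier triple. [cite: Zhang2022LandauSiegel, §2 (2.13)] -/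
theorem vernierRecipe_b (b₀ : ℝ) (J : ℕ) (m : ℝ) : (vernierRecipe b₀ J m).b = vernierShifts b₀ J m := rfl

/-- **The θ-blind control statement (E*-S (ii) slot instance, OPEN — asserted by no one):** the diagonal form of
the `θ = 0` vernier recipe is PSD on one-sided kinked profiles, `Det.FormDetPSD (vernierRecipe b₀ J m)`. The card's
sanity clause predicts TRUE (a θ-free negativity would be «¬(A) for free»); a certified/kernel decision either way is
the Cheapest falsifier's first line (`Det.formDet_eq_moments` gives the form through six channel moments of
`Det.shiftW (vernierShifts b₀ J m)`). [cite: Zhang2022LandauSiegel, Prop 7.1 p.44, (7.2), (7.19)–(7.21)] -/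
def VernierThetaBlindPSD (b₀ : ℝ) (J : ℕ) (m : ℝ) : Prop := Det.FormDetPSD (vernierRecipe b₀ J m)

/-- At `J = 2`, `m = 0`, `b₀ = 1` the vernier recipe is the PRINTED recipe (`Det.shiftRecipe_std`), whose PSD slot is
the theorem `Det.formDetPSD_zhang`: the control statement holds at the printed design.
[cite: Zhang2022LandauSiegel, Prop 7.1 with (8.11)–(8.23), pp.44–50] -/
theorem vernierThetaBlindPSD_printed : VernierThetaBlindPSD 1 2 0 := by
  have h : vernierShifts 1 2 0 = ![1, 2, 3] := by
    funext j; fin_cases j <;> norm_num [vernierShifts]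
  unfold VernierThetaBlindPSD vernierRecipe
  rw [h, Det.shiftRecipe_std]
  exact Det.formDetPSD_zhang

end Control

/-! ## BOOKING: the two-parameter family of recipes the deriver's D1 must pin (critic's REQUEST 23:54:54Z:
«book ALL mismatch phases — prefactor `(pt₀)^{Σβ/2−β_j}`, `p^{−β_j}` — AND the integrand coefficient deformation
`b → (1+δ)b, s → (1+δ)s, n → (1+δ)²n` in grid units (the `ellRecipe` pattern)»). A PARAMETRISATION, not a guess:
channel phases `φ_j` and dilation `δ` are free; the card's `𝔅^V_θ` is `Det.FormDet (vernierBooked b₀ J m (δ θ) (φ θ))`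
for the deriver's functions `δ(θ), φ(θ)` (D1), which this file does not supply. -/

section Booking

open Det

/-- **The booked recipe of a shift triple `b`, dilation `δ` and channel phases `φ`:** weights
`W_j = shiftW b j · e^{iπφ_j}`, integrand coefficients `((1+δ)b, (1+δ)s(b), (1+δ)²n(b))`. At `φ = 0, δ = 0` this is
`Det.shiftRecipe b`; at `b = (1,2,3), φ = 0, δ = ℓ − 1` it is `Det.ellRecipe ℓ`.
[cite: Zhang2022LandauSiegel, Prop 7.1, (7.19)–(7.21); §2 (2.10), (2.13)] -/
def bookedRecipe (b : Fin 3 → ℝ) (δ : ℝ) (φ : Fin 3 → ℝ) : DetRecipe where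
  W := fun j => shiftW b j * Complex.exp (Complex.I * π * (φ j : ℂ))
  b := fun j => (1 + δ) * b j
  s := fun j => (1 + δ) * shiftS b j
  n := fun j => (1 + δ) ^ 2 * shiftN b j

/-- No phases, no dilation: the booked recipe is the tree's shift-triple recipe. [cite: Zhang2022LandauSiegel, Prop 7.1, (7.19)–(7.21)] -/
theorem bookedRecipe_zero (b : Fin 3 → ℝ) : bookedRecipe b 0 (fun _ => 0) = shiftRecipe b := by
  ext j <;> simp [bookedRecipe, shiftRecipe]

/-- At the printed triple with no phases, dilation `δ = ℓ − 1` gives the `ℓ`-recipe of `MainTermFormEllRecipe`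
(`F_ℓ = FormDet (ellRecipe ℓ)`): the booking unifies the `ℓ`-deformation (p429407/p463235) and the shift-set
coordinate (`shiftRecipe`). [cite: Zhang2022LandauSiegel, Prop 7.1, (7.19)–(7.21); §2 (2.10), (2.13)] -/
theorem bookedRecipe_std_dilate (ℓ : ℝ) : bookedRecipe ![1, 2, 3] (ℓ - 1) (fun _ => 0) = ellRecipe ℓ := by
  have hW : ∀ j, shiftW ![1, 2, 3] j = (ellRecipe ℓ).W j := by
    intro j
    rw [ellRecipe_W, ← shiftRecipe_std]
    rfl
  ext j
  · simp only [bookedRecipe, Complex.ofReal_zero, mul_zero, Complex.exp_zero, mul_one, hW]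
  · simp only [bookedRecipe, ellRecipe, zhangRecipe]; ring
  · simp only [bookedRecipe, ellRecipe, zhangRecipe, shiftS_std]; ring
  · simp only [bookedRecipe, ellRecipe, zhangRecipe, shiftN_std]; ring

/-- **The booked vernier recipe** (far pair `(b₀; J+m, J+1−m)`, dilation `δ`, phases `φ`): the deriver's `𝔅^V_θ`
is `Det.FormDet (vernierBooked b₀ J m (δ θ) (φ θ))` for the D1 functions `δ(θ), φ(θ)` — NOT supplied here.
[cite: Zhang2022LandauSiegel, Prop 7.1, (7.19)–(7.21); §2 (2.13)] -/
def vernierBooked (b₀ : ℝ) (J : ℕ) (m δ : ℝ) (φ : Fin 3 → ℝ) : DetRecipe :=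
  bookedRecipe (vernierShifts b₀ J m) δ φ

/-- No booking = the θ-blind control recipe. [cite: Zhang2022LandauSiegel, Prop 7.1, (7.19)–(7.21)] -/
theorem vernierBooked_zero (b₀ : ℝ) (J : ℕ) (m : ℝ) :
    vernierBooked b₀ J m 0 (fun _ => 0) = vernierRecipe b₀ J m := bookedRecipe_zero _

/-- **The certified-scan target (OPEN, asserted by no one):** `Det.FormDetPSD (vernierBooked b₀ J m δ φ)` — the
critic's «ONE certified eigen-scan over (θ, m, J) on the constrained span» decides this family at the deriver's
`(δ(θ), φ(θ))`; the critic's float caricature (one phase on channel 0) is negative for `|φ₀| ≥ 0.4`, the θ-blind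
member is PSD on the tested span. [cite: Zhang2022LandauSiegel, Prop 7.1 p.44, (7.2)] -/
def VernierBookedPSD (b₀ : ℝ) (J : ℕ) (m δ : ℝ) (φ : Fin 3 → ℝ) : Prop := FormDetPSD (vernierBooked b₀ J m δ φ)

/-- K1 in this parametrisation (OPEN shape): a NEGATIVE witness for the booked vernier form —
`Det.FormDetNegWitness (vernierBooked …)` — is exactly `¬ VernierBookedPSD …` (`Det.not_formDetPSD_iff`).
[cite: Zhang2022LandauSiegel, Prop 7.1 p.44, (7.2)] -/
theorem not_vernierBookedPSD_iff (b₀ : ℝ) (J : ℕ) (m δ : ℝ) (φ : Fin 3 → ℝ) :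
    ¬ VernierBookedPSD b₀ J m δ φ ↔ FormDetNegWitness (vernierBooked b₀ J m δ φ) :=
  not_formDetPSD_iff _

end Booking

/-! ## K2 PINNED by the card's author (ls-knife-ell-idea-2 g2, cell INBOX 2026-08-26T23:59:54Z): `Φ′ := L_Δ(p)`,
the constant true-fence density (ψ- and t-free; the ψ-dependent drift `−2Re(L′/L)(1+2it,ψ²)` of a coherent member
is absorbed by the tolerance `o(𝓛^{−1/4})·α̃`, the smooth `t`-drift is `≪ 𝓛^{−100}α̃`). The second reader
(ls-knife-crit-3 g4, 2026-08-27T00:00:51Z) recommends instead `Φ′ := L_Δ + Re(F′/F)(½+it,ψ)` with an `Fpoly`-defined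
sub-family and a fixed margin — NOT typed here (a different statement; to be typed on request as `VernierCoherence'`). -/

section Pinned

open Skeleton

/-- **The author's pin of K2's phase density: `Φ′(D, ψ, t) := L_Δ(p)`** (`EllScales.Scales.LDelta` at the printed
scales; constant in `t` and in `ψ`). [cite: Zhang2022LandauSiegel, §2 (2.10); §4 (4.10)–(4.11)] -/
def PhiFence (D : ℕ) (x : Chr D) (_t : ℝ) : ℝ := (EllScales.Scales.pinned D).LDelta x.p

/-- `π/Φ′ = α̃(p)` literally (so K2's predicted gaps are exactly the true-fence unit K4 consumes).
[cite: Zhang2022LandauSiegel, §2 (2.10)] -/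
@[simp] theorem pi_div_phiFence (D : ℕ) (x : Chr D) (t : ℝ) : π / PhiFence D x t = alphaFence D x.p := rfl

/-- **Crux K2 in the author's pinned form (OPEN, asserted by no one):** `VernierCoherence θ PhiFence` — coherent
members follow the RIGID fence `α̃(p)` to cumulative precision `o(𝓛^{−1/4})·α̃` over the `J+1` gaps the far pair
needs (tribunal desk 23:58:04Z: with `Φ′` pinned the statement carries content; with `Φ′` free it is decoration).
[cite: Zhang2022LandauSiegel, §4 (4.10)–(4.11), Lemmas 4.5–4.6, Prop. 2.2] -/
def VernierCoherenceFence (θ : ℝ) : Prop := VernierCoherence θ PhiFence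

/-- Unfolding: the pinned K2 is the parametrised K2 at `Φ′ = PhiFence`. [cite: Zhang2022LandauSiegel, §4 (4.10)–(4.11)] -/
theorem vernierCoherenceFence_iff (θ : ℝ) : VernierCoherenceFence θ ↔ VernierCoherence θ PhiFence := Iff.rfl

end Pinned

end Literature.NumberTheory.LFunctions.Zhang2022.KnifeEdgeEll.Vernier

end
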